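import Summits.BirchSwinnertonDyer.Rank1Residual.JET.CarrierReadingRecordsKitFed
import Summits.BirchSwinnertonDyer.BirchSwinnertonDyer.Theorems.Rank1ResidualJetCarrierAddKit
import Summits.BirchSwinnertonDyer.BirchSwinnertonDyer.Theorems.Rank1ResidualJetCarrierMultKitOrder
import HarnessLib

/-!
# T1 JET (cell `bsd-jet`): FED twins of the PROVER kits' record doors — `hrec`, `hD36` supplied by Literature
# theorems, `hlev` reduced to modularity (sibling of `CarrierReadingRecordsKitFed`)

HONEST FRAMING (programme `BSD-LIT2PART-PROGRAMME-v1.md` §HONESTY, verbatim): «no tranche here proves BSD;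
ARM L moves the LITERAL column of an r ≤ 1 census into the kernel-proved-modulo-named-print column; ARM P
changes what «named print» is worth.» THEOREMS ONLY; nothing is booked by this file; nothing about any particular
curve is asserted. Seat `bsd-jet-ty` (typer), session g6.

WHAT THIS FILE IS. The by-name JET records of the bucket-B samples (`JET/JetDocstrikeBRecords01–07`,
`JetDocstrikeDatumRecords01–05`, `JetD1…`/CJ samples) that sit at an ADDITIVE `3` or use a per-row image witness
apply the prover seat `bsd-jet-pv-2`'s record doors `JET.bsdp_of_jetRowCarrierAdd_three_of_frobenius`
(`Theorems/Rank1ResidualJetCarrierAddKit`), `JET.bsdp_of_jetRowCarrierMult_of_serreWitnesses` / `_of_ram`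
(`Theorems/Rank1ResidualJetCarrierMultKit`) and `JET.bsdp_of_jetRowCarrierMult_of_irr_of_order`
(`Theorems/Rank1ResidualJetCarrierMultKitOrder`). Exactly as in the sibling file (whose §0 feeders
`heegnerPointOfConductor_one_galoisConj_forall`, `level_eq_conductorNorm_forall_of_exists_isNewformOf` and the
term `fun N _ W K _ _ => phi_heegnerTau_mem_singularModuliField_holds N W K` are reused here), each door gets a FED twin `<door>_fed`:
the same statement with the displayed binders `hrec` (Shimura reciprocity for `y(1)`, Darmon Thm. 3.7 — Literature
theorem `heegnerPointOfConductor_one_galoisConj_holds`) and `hD36` (Darmon Thm. 3.6 at conductor `1` — Literature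
theorem `phi_heegnerTau_mem_singularModuliField_holds`) REMOVED, and `hlev` (Carayol) REPLACED by the modularity
binder `hmod : exists_isNewformOf` (`IsNewformOf.level_eq_conductorNorm_of_exists_isNewformOf'`); proof = the door
with every explicit binder passed by name. The prover files are not modified. PARTITION: row D5 `JET@p∣N` —
0 classes moved by this file.

References: H. Darmon, CBMS 101 (2004) Thm. 3.6 / 3.7 [Darmon2004]; B. H. Gross, LMS LN 153 (1991) §4
[GrossLMS1991]; Atkin–Lehner, Math. Ann. 185 (1970) Thm. 4 [AtkinLehner1970]; Diamond–Shurman, GTM 228 (2005)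
Thm. 8.8.1 [DiamondShurman2005]; D. Jetchev, Compos. Math. 144 (2008) Thm. 1.4, Cor. 1.5 [Jetchev2008].
-/

set_option autoImplicit false

noncomputable section

open scoped Classical

open IsDedekindDomain NumberField Rat.HeightOneSpectrum WeierstrassCurve Literature.NumberTheory.EllipticCurves
  Literature.NumberTheory.EllipticCurves.ModularForms
  Literature.NumberTheory.EllipticCurves.Rank1Residual
  Literature.NumberTheory.EllipticCurves.Rank1Residual.Typed
  Literature.NumberTheory.EllipticCurves.Rank1Residual.X11RankOneCertificates
  Summit.BirchSwinnertonDyer.BirchSwinnertonDyer.Rank1Residual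
  Summit.BirchSwinnertonDyer.BirchSwinnertonDyer.Rank1Residual.IntModel
  Summit.BirchSwinnertonDyer.BirchSwinnertonDyer.Rank1Residual.X11RankOne
  Summit.BirchSwinnertonDyer.BirchSwinnertonDyer.Rank2Observatory.Tam
  Summit.BirchSwinnertonDyer.Rank1Residual Summit.BirchSwinnertonDyer.Rank1Residual.X11b

namespace Summit.BirchSwinnertonDyer.Rank1Residual.JET

/-! ## §1 bucket B, `p = 3` additive at `3` (prover kit `Rank1ResidualJetCarrierAddKit`) -/

/-- **FED twin of `JET.bsdp_of_jetRowCarrierAdd_three_of_frobenius`** — bucket B, `p = 3` ADDITIVE at `3`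
(carrier `3` of type `IV`/`IV*`), Kraus-minimality + three Frobenius witnesses (prover `bsd-jet-pv-2`'s kit
p475627; 36 landed records): the door's statement with `hrec` / `hD36` SUPPLIED by the Literature theorems
and `hlev` by `hmod : exists_isNewformOf`; every other binder verbatim, by name. -/
theorem bsdp_of_jetRowCarrierAdd_three_of_frobenius_fed
    (a1 a2 a3 a4 a6 : ℤ) (h0 : discOf [a1, a2, a3, a4, a6] ≠ 0) (bad : List (ℕ × ℕ × ℕ))
    (hprime : ∀ t ∈ bad, t.1.Prime)
    (hsupp : (discOf [a1, a2, a3, a4, a6]).natAbs = (bad.map fun t => t.1 ^ t.2.2).prod)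
    (hmin : ∀ t ∈ bad,
      (¬ (t.1 : ℤ) ^ 12 ∣ discOf [a1, a2, a3, a4, a6] ∨ ¬ (t.1 : ℤ) ^ 4 ∣ c4Of [a1, a2, a3, a4, a6]) ∨
      (t.1 = 2 ∧ (16 : ℤ) ∣ c4Of [a1, a2, a3, a4, a6] ∧ (64 : ℤ) ∣ c6Of [a1, a2, a3, a4, a6] ∧
      ¬ (((16 : ℤ) ∣ c4Of [a1, a2, a3, a4, a6] / 16 ∧
      ((32 : ℤ) ∣ c6Of [a1, a2, a3, a4, a6] / 64 ∨ (32 : ℤ) ∣ c6Of [a1, a2, a3, a4, a6] / 64 - 8)) ∨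
      (4 : ℤ) ∣ c6Of [a1, a2, a3, a4, a6] / 64 + 1)) ∨
      (t.1 = 3 ∧ (3 : ℤ) ^ 8 ∣ c6Of [a1, a2, a3, a4, a6] ∧ ¬ (3 : ℤ) ^ 9 ∣ c6Of [a1, a2, a3, a4, a6]))
    (h3Δ : (3 : ℤ) ∣ (⟨a1, a2, a3, a4, a6⟩ : WeierstrassCurve ℤ).Δ)
    (h3c₄ : (3 : ℤ) ∣ (⟨a1, a2, a3, a4, a6⟩ : WeierstrassCurve ℤ).c₄) (ℓ₁ ℓ₂ ℓ₃ : ℕ)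
    (hℓ₁ : ℓ₁.Prime) (hℓ₂ : ℓ₂.Prime) (hℓ₃ : ℓ₃.Prime) (h2ℓ₁ : ℓ₁ ≠ 2) (h2ℓ₂ : ℓ₂ ≠ 2)
    (h2ℓ₃ : ℓ₃ ≠ 2) (h3ℓ₁ : ℓ₁ ≠ 3) (h3ℓ₂ : ℓ₂ ≠ 3)
    (hΔ₁ : ¬ (ℓ₁ : ℤ) ∣ (⟨a1, a2, a3, a4, a6⟩ : WeierstrassCurve ℤ).Δ)
    (hΔ₂ : ¬ (ℓ₂ : ℤ) ∣ (⟨a1, a2, a3, a4, a6⟩ : WeierstrassCurve ℤ).Δ)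
    (hΔ₃ : ¬ (ℓ₃ : ℤ) ∣ (⟨a1, a2, a3, a4, a6⟩ : WeierstrassCurve ℤ).Δ) {n₁ n₂ n₃ : ℕ}
    (hc₁ : countPoints [a1, a2, a3, a4, a6] ℓ₁ = n₁)
    (hc₂ : countPoints [a1, a2, a3, a4, a6] ℓ₂ = n₂)
    (hc₃ : countPoints [a1, a2, a3, a4, a6] ℓ₃ = n₃)
    (hi : ∀ c : ZMod 3, c ^ 2 - (((ℓ₁ : ℤ) + 1 - n₁ : ℤ) : ZMod 3) * c + ℓ₁ ≠ 0)
    (hii : (ℓ₂ : ZMod 3) = 1 ∧ (((ℓ₂ : ℤ) + 1 - n₂ : ℤ) : ZMod 3) = 2 ∧ ¬ 9 ∣ n₂)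
    (hiii : (ℓ₃ % 9 = 2 ∨ ℓ₃ % 9 = 5) ∧
      (((ℓ₃ : ℤ) + 1 - n₃) % 9 = 3 ∨ ((ℓ₃ : ℤ) + 1 - n₃) % 9 = 6))
    (hJ : JetchevDivisibilityCarrierAdd)
    (hMcU : McCallum1991_padicValNat_card_sha_primary_add_le_of_globalDivisibility)
    (hGZK : rank_eq_analyticRank_of_analyticRank_le_one)
    (hKo : ∀ (N : ℕ) [NeZero N] (W : WeierstrassCurve ℚ) (K : Type) [Field K] [NumberField K],
      kolyvagin N W K)
    (hmod : exists_isNewformOf) (W : WeierstrassCurve ℚ) (hW : W = ⟨a1, a2, a3, a4, a6⟩) {N : ℕ}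
    [NeZero N] {K : Type} [Field K] [NumberField K] (hK : IsImaginaryQuadratic K)
    (hD3 : NumberField.discr K ≠ -3) (hD4 : NumberField.discr K ≠ -4)
    (hH : SatisfiesHeegnerHypothesis N K) {P : (W.baseChange K).toAffine.Point}
    (hP : IsHeegnerPoint N W K P) (hnt : ¬ IsOfFinAddOrder P)
    (hI : padicValNat 3 (AddSubgroup.zmultiples P).index ≤
      padicValNat 3 ((W.baseChange ℚ_[3]).localTamagawaNumber ℤ_[3]))
    (hr : W.analyticRank ≤ 1) {s : ℚ} (hs : shaAn W = (s : ℂ)) (hv : padicValRat 3 s = 0) :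
    BSDp W 3 :=
  bsdp_of_jetRowCarrierAdd_three_of_frobenius
    (a1 := a1) (a2 := a2) (a3 := a3) (a4 := a4) (a6 := a6) (h0 := h0) (bad := bad)
    (hprime := hprime) (hsupp := hsupp) (hmin := hmin) (h3Δ := h3Δ) (h3c₄ := h3c₄) (ℓ₁ := ℓ₁)
    (ℓ₂ := ℓ₂) (ℓ₃ := ℓ₃) (hℓ₁ := hℓ₁) (hℓ₂ := hℓ₂) (hℓ₃ := hℓ₃) (h2ℓ₁ := h2ℓ₁) (h2ℓ₂ := h2ℓ₂)
    (h2ℓ₃ := h2ℓ₃) (h3ℓ₁ := h3ℓ₁) (h3ℓ₂ := h3ℓ₂) (hΔ₁ := hΔ₁) (hΔ₂ := hΔ₂) (hΔ₃ := hΔ₃) (hc₁ := hc₁)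
    (hc₂ := hc₂) (hc₃ := hc₃) (hi := hi) (hii := hii) (hiii := hiii) (hJ := hJ) (hMcU := hMcU)
    (hGZK := hGZK) (hKo := hKo) (hrec := heegnerPointOfConductor_one_galoisConj_forall)
    (hD36 := (fun N _ W K _ _ => phi_heegnerTau_mem_singularModuliField_holds N W K))
    (hlev := (level_eq_conductorNorm_forall_of_exists_isNewformOf hmod)) (W := W) (hW := hW)
    (hK := hK) (hD3 := hD3) (hD4 := hD4) (hH := hH) (hP := hP) (hnt := hnt) (hI := hI) (hr := hr)
    (hs := hs) (hv := hv)

/-! ## §2 bucket B, carrier `p` split multiplicative (prover kits `Rank1ResidualJetCarrierMultKit[Order]`) -/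

/-- **FED twin of `JET.bsdp_of_jetRowCarrierMult_of_serreWitnesses`** — bucket B, `p ≥ 5`, carrier `p` split
multiplicative, image by three Serre witnesses (prover `bsd-jet-pv-2`'s kit p465088; 8 landed records): the
door's statement with `hrec` / `hD36` SUPPLIED by the Literature theorems and `hlev` by `hmod :
exists_isNewformOf`; every other binder verbatim, by name. -/
theorem bsdp_of_jetRowCarrierMult_of_serreWitnesses_fed
    (p : ℕ) (hp : p.Prime) (h5 : 5 ≤ p) (a1 a2 a3 a4 a6 : ℤ) (h0 : discOf [a1, a2, a3, a4, a6] ≠ 0)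
    (bad : List (ℕ × ℕ × ℕ)) (hprime : ∀ t ∈ bad, t.1.Prime)
    (hsupp : (discOf [a1, a2, a3, a4, a6]).natAbs = (bad.map fun t => t.1 ^ t.2.2).prod)
    (hmin : ∀ t ∈ bad,
      (¬ (t.1 : ℤ) ^ 12 ∣ discOf [a1, a2, a3, a4, a6] ∨ ¬ (t.1 : ℤ) ^ 4 ∣ c4Of [a1, a2, a3, a4, a6]) ∨
      (t.1 = 2 ∧ (16 : ℤ) ∣ c4Of [a1, a2, a3, a4, a6] ∧ (64 : ℤ) ∣ c6Of [a1, a2, a3, a4, a6] ∧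
      ¬ (((16 : ℤ) ∣ c4Of [a1, a2, a3, a4, a6] / 16 ∧
      ((32 : ℤ) ∣ c6Of [a1, a2, a3, a4, a6] / 64 ∨ (32 : ℤ) ∣ c6Of [a1, a2, a3, a4, a6] / 64 - 8)) ∨
      (4 : ℤ) ∣ c6Of [a1, a2, a3, a4, a6] / 64 + 1)) ∨
      (t.1 = 3 ∧ (3 : ℤ) ^ 8 ∣ c6Of [a1, a2, a3, a4, a6] ∧ ¬ (3 : ℤ) ^ 9 ∣ c6Of [a1, a2, a3, a4, a6]))
    (hpΔ : (p : ℤ) ∣ (⟨a1, a2, a3, a4, a6⟩ : WeierstrassCurve ℤ).Δ)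
    (hpc₄ : ¬ (p : ℤ) ∣ (⟨a1, a2, a3, a4, a6⟩ : WeierstrassCurve ℤ).c₄) (ℓ₁ ℓ₂ ℓ₃ : ℕ)
    (hℓ₁ : ℓ₁.Prime) (hℓ₂ : ℓ₂.Prime) (hℓ₃ : ℓ₃.Prime) (h2ℓ₁ : ℓ₁ ≠ 2) (h2ℓ₂ : ℓ₂ ≠ 2)
    (h2ℓ₃ : ℓ₃ ≠ 2) (hℓ₁p : ℓ₁ ≠ p) (hℓ₂p : ℓ₂ ≠ p) (hℓ₃p : ℓ₃ ≠ p)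
    (hΔ₁ : ¬ (ℓ₁ : ℤ) ∣ (⟨a1, a2, a3, a4, a6⟩ : WeierstrassCurve ℤ).Δ)
    (hΔ₂ : ¬ (ℓ₂ : ℤ) ∣ (⟨a1, a2, a3, a4, a6⟩ : WeierstrassCurve ℤ).Δ)
    (hΔ₃ : ¬ (ℓ₃ : ℤ) ∣ (⟨a1, a2, a3, a4, a6⟩ : WeierstrassCurve ℤ).Δ) {n₁ n₂ n₃ : ℕ}
    (hc₁ : countPoints [a1, a2, a3, a4, a6] ℓ₁ = n₁)
    (hc₂ : countPoints [a1, a2, a3, a4, a6] ℓ₂ = n₂)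
    (hc₃ : countPoints [a1, a2, a3, a4, a6] ℓ₃ = n₃)
    (hi : IsSquare ((((ℓ₁ : ℤ) + 1 - n₁ : ℤ) : ZMod p) ^ 2 - 4 * ℓ₁) ∧
      (((ℓ₁ : ℤ) + 1 - n₁ : ℤ) : ZMod p) ^ 2 - 4 * ℓ₁ ≠ 0 ∧ (((ℓ₁ : ℤ) + 1 - n₁ : ℤ) : ZMod p) ≠ 0)
    (hii : ¬ IsSquare ((((ℓ₂ : ℤ) + 1 - n₂ : ℤ) : ZMod p) ^ 2 - 4 * ℓ₂) ∧
      (((ℓ₂ : ℤ) + 1 - n₂ : ℤ) : ZMod p) ≠ 0)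
    (hiii : ∃ u : ZMod p, (((ℓ₃ : ℤ) + 1 - n₃ : ℤ) : ZMod p) ^ 2 = u * ℓ₃ ∧
      u ≠ 0 ∧ u ≠ 1 ∧ u ≠ 2 ∧ u ≠ 4 ∧ u ^ 2 - 3 * u + 1 ≠ 0)
    (hJ : JetchevDivisibilityCarrierMult)
    (hMcU : McCallum1991_padicValNat_card_sha_primary_add_le_of_globalDivisibility)
    (hGZK : rank_eq_analyticRank_of_analyticRank_le_one)
    (hKo : ∀ (N : ℕ) [NeZero N] (W : WeierstrassCurve ℚ) (K : Type) [Field K] [NumberField K],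
      kolyvagin N W K)
    (hmod : exists_isNewformOf) (W : WeierstrassCurve ℚ) (hW : W = ⟨a1, a2, a3, a4, a6⟩) {N : ℕ}
    [NeZero N] {K : Type} [Field K] [NumberField K] (hK : IsImaginaryQuadratic K)
    (hD3 : NumberField.discr K ≠ -3) (hD4 : NumberField.discr K ≠ -4)
    (hH : SatisfiesHeegnerHypothesis N K) {P : (W.baseChange K).toAffine.Point}
    (hP : IsHeegnerPoint N W K P) (hnt : ¬ IsOfFinAddOrder P)
    (hI : (haveI := Fact.mk hp;
      padicValNat p (AddSubgroup.zmultiples P).index ≤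
      padicValNat p ((W.baseChange ℚ_[p]).localTamagawaNumber ℤ_[p])))
    (hr : W.analyticRank ≤ 1) {s : ℚ} (hs : shaAn W = (s : ℂ)) (hv : padicValRat p s = 0) :
    BSDp W p :=
  bsdp_of_jetRowCarrierMult_of_serreWitnesses
    (p := p) (hp := hp) (h5 := h5) (a1 := a1) (a2 := a2) (a3 := a3) (a4 := a4) (a6 := a6) (h0 := h0)
    (bad := bad) (hprime := hprime) (hsupp := hsupp) (hmin := hmin) (hpΔ := hpΔ) (hpc₄ := hpc₄)
    (ℓ₁ := ℓ₁) (ℓ₂ := ℓ₂) (ℓ₃ := ℓ₃) (hℓ₁ := hℓ₁) (hℓ₂ := hℓ₂) (hℓ₃ := hℓ₃) (h2ℓ₁ := h2ℓ₁)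
    (h2ℓ₂ := h2ℓ₂) (h2ℓ₃ := h2ℓ₃) (hℓ₁p := hℓ₁p) (hℓ₂p := hℓ₂p) (hℓ₃p := hℓ₃p) (hΔ₁ := hΔ₁)
    (hΔ₂ := hΔ₂) (hΔ₃ := hΔ₃) (hc₁ := hc₁) (hc₂ := hc₂) (hc₃ := hc₃) (hi := hi) (hii := hii)
    (hiii := hiii) (hJ := hJ) (hMcU := hMcU) (hGZK := hGZK) (hKo := hKo)
    (hrec := heegnerPointOfConductor_one_galoisConj_forall)
    (hD36 := (fun N _ W K _ _ => phi_heegnerTau_mem_singularModuliField_holds N W K))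
    (hlev := (level_eq_conductorNorm_forall_of_exists_isNewformOf hmod)) (W := W) (hW := hW)
    (hK := hK) (hD3 := hD3) (hD4 := hD4) (hH := hH) (hP := hP) (hnt := hnt) (hI := hI) (hr := hr)
    (hs := hs) (hv := hv)

/-- **FED twin of `JET.bsdp_of_jetRowCarrierMult_of_ram`** — bucket B, carrier `p` split multiplicative, image
by a (ram) multiplicative prime (pv-2's kit p465088; 24 landed records): the door's statement with `hrec` /
`hD36` SUPPLIED by the Literature theorems and `hlev` by `hmod : exists_isNewformOf`; every other binder
verbatim, by name. -/
theorem bsdp_of_jetRowCarrierMult_of_ram_fed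
    (p : ℕ) (hp : p.Prime) (hp2 : p ≠ 2) (a1 a2 a3 a4 a6 : ℤ) (h0 : discOf [a1, a2, a3, a4, a6] ≠ 0)
    (bad : List (ℕ × ℕ × ℕ)) (hprime : ∀ t ∈ bad, t.1.Prime)
    (hsupp : (discOf [a1, a2, a3, a4, a6]).natAbs = (bad.map fun t => t.1 ^ t.2.2).prod)
    (hmin : ∀ t ∈ bad,
      (¬ (t.1 : ℤ) ^ 12 ∣ discOf [a1, a2, a3, a4, a6] ∨ ¬ (t.1 : ℤ) ^ 4 ∣ c4Of [a1, a2, a3, a4, a6]) ∨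
      (t.1 = 2 ∧ (16 : ℤ) ∣ c4Of [a1, a2, a3, a4, a6] ∧ (64 : ℤ) ∣ c6Of [a1, a2, a3, a4, a6] ∧
      ¬ (((16 : ℤ) ∣ c4Of [a1, a2, a3, a4, a6] / 16 ∧
      ((32 : ℤ) ∣ c6Of [a1, a2, a3, a4, a6] / 64 ∨ (32 : ℤ) ∣ c6Of [a1, a2, a3, a4, a6] / 64 - 8)) ∨
      (4 : ℤ) ∣ c6Of [a1, a2, a3, a4, a6] / 64 + 1)) ∨
      (t.1 = 3 ∧ (3 : ℤ) ^ 8 ∣ c6Of [a1, a2, a3, a4, a6] ∧ ¬ (3 : ℤ) ^ 9 ∣ c6Of [a1, a2, a3, a4, a6]))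
    (hpΔ : (p : ℤ) ∣ (⟨a1, a2, a3, a4, a6⟩ : WeierstrassCurve ℤ).Δ)
    (hpc₄ : ¬ (p : ℤ) ∣ (⟨a1, a2, a3, a4, a6⟩ : WeierstrassCurve ℤ).c₄) (ℓ : ℕ) (hℓ : ℓ.Prime)
    (h2ℓ : ℓ ≠ 2) (hℓp : ℓ ≠ p) (hΔℓ : ¬ (ℓ : ℤ) ∣ (⟨a1, a2, a3, a4, a6⟩ : WeierstrassCurve ℤ).Δ)
    {n : ℕ} (hc : countPoints [a1, a2, a3, a4, a6] ℓ = n)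
    (hnoroot : ∀ t : ZMod p, t ^ 2 - (((ℓ : ℤ) + 1 - n : ℤ) : ZMod p) * t + (ℓ : ZMod p) ≠ 0)
    (m : ℕ) (hm : m.Prime) (hmp : m ≠ p)
    (hmΔ : (m : ℤ) ∣ (⟨a1, a2, a3, a4, a6⟩ : WeierstrassCurve ℤ).Δ)
    (hmc₄ : ¬ (m : ℤ) ∣ (⟨a1, a2, a3, a4, a6⟩ : WeierstrassCurve ℤ).c₄) {e : ℕ}
    (hme : (m : ℤ) ^ e ∣ (⟨a1, a2, a3, a4, a6⟩ : WeierstrassCurve ℤ).Δ)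
    (hme' : ¬ (m : ℤ) ^ (e + 1) ∣ (⟨a1, a2, a3, a4, a6⟩ : WeierstrassCurve ℤ).Δ) (hpe : ¬ p ∣ e)
    (hJ : JetchevDivisibilityCarrierMult)
    (hMcU : McCallum1991_padicValNat_card_sha_primary_add_le_of_globalDivisibility)
    (hGZK : rank_eq_analyticRank_of_analyticRank_le_one)
    (hKo : ∀ (N : ℕ) [NeZero N] (W : WeierstrassCurve ℚ) (K : Type) [Field K] [NumberField K],
      kolyvagin N W K)
    (hmod : exists_isNewformOf) (W : WeierstrassCurve ℚ) (hW : W = ⟨a1, a2, a3, a4, a6⟩) {N : ℕ}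
    [NeZero N] {K : Type} [Field K] [NumberField K] (hK : IsImaginaryQuadratic K)
    (hD3 : NumberField.discr K ≠ -3) (hD4 : NumberField.discr K ≠ -4)
    (hH : SatisfiesHeegnerHypothesis N K) {P : (W.baseChange K).toAffine.Point}
    (hP : IsHeegnerPoint N W K P) (hnt : ¬ IsOfFinAddOrder P)
    (hI : (haveI := Fact.mk hp;
      padicValNat p (AddSubgroup.zmultiples P).index ≤
      padicValNat p ((W.baseChange ℚ_[p]).localTamagawaNumber ℤ_[p])))
    (hr : W.analyticRank ≤ 1) {s : ℚ} (hs : shaAn W = (s : ℂ)) (hv : padicValRat p s = 0) :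
    BSDp W p :=
  bsdp_of_jetRowCarrierMult_of_ram
    (p := p) (hp := hp) (hp2 := hp2) (a1 := a1) (a2 := a2) (a3 := a3) (a4 := a4) (a6 := a6)
    (h0 := h0) (bad := bad) (hprime := hprime) (hsupp := hsupp) (hmin := hmin) (hpΔ := hpΔ)
    (hpc₄ := hpc₄) (ℓ := ℓ) (hℓ := hℓ) (h2ℓ := h2ℓ) (hℓp := hℓp) (hΔℓ := hΔℓ) (hc := hc)
    (hnoroot := hnoroot) (m := m) (hm := hm) (hmp := hmp) (hmΔ := hmΔ) (hmc₄ := hmc₄) (hme := hme)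
    (hme' := hme') (hpe := hpe) (hJ := hJ) (hMcU := hMcU) (hGZK := hGZK) (hKo := hKo)
    (hrec := heegnerPointOfConductor_one_galoisConj_forall)
    (hD36 := (fun N _ W K _ _ => phi_heegnerTau_mem_singularModuliField_holds N W K))
    (hlev := (level_eq_conductorNorm_forall_of_exists_isNewformOf hmod)) (W := W) (hW := hW)
    (hK := hK) (hD3 := hD3) (hD4 := hD4) (hH := hH) (hP := hP) (hnt := hnt) (hI := hI) (hr := hr)
    (hs := hs) (hv := hv)

/-- **FED twin of `JET.bsdp_of_jetRowCarrierMult_of_irr_of_order`** — bucket B, `p` odd, carrier `p` split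
multiplicative, image by an irreducible Frobenius + an element of order `p` (pv-2's kit p466045-series
`…KitOrder`; 30 landed records): the door's statement with `hrec` / `hD36` SUPPLIED by the Literature
theorems and `hlev` by `hmod : exists_isNewformOf`; every other binder verbatim, by name. -/
theorem bsdp_of_jetRowCarrierMult_of_irr_of_order_fed
    (p : ℕ) (hp : p.Prime) (hp2 : p ≠ 2) (a1 a2 a3 a4 a6 : ℤ) (h0 : discOf [a1, a2, a3, a4, a6] ≠ 0)
    (bad : List (ℕ × ℕ × ℕ)) (hprime : ∀ t ∈ bad, t.1.Prime)
    (hsupp : (discOf [a1, a2, a3, a4, a6]).natAbs = (bad.map fun t => t.1 ^ t.2.2).prod)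
    (hmin : ∀ t ∈ bad,
      (¬ (t.1 : ℤ) ^ 12 ∣ discOf [a1, a2, a3, a4, a6] ∨ ¬ (t.1 : ℤ) ^ 4 ∣ c4Of [a1, a2, a3, a4, a6]) ∨
      (t.1 = 2 ∧ (16 : ℤ) ∣ c4Of [a1, a2, a3, a4, a6] ∧ (64 : ℤ) ∣ c6Of [a1, a2, a3, a4, a6] ∧
      ¬ (((16 : ℤ) ∣ c4Of [a1, a2, a3, a4, a6] / 16 ∧
      ((32 : ℤ) ∣ c6Of [a1, a2, a3, a4, a6] / 64 ∨ (32 : ℤ) ∣ c6Of [a1, a2, a3, a4, a6] / 64 - 8)) ∨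
      (4 : ℤ) ∣ c6Of [a1, a2, a3, a4, a6] / 64 + 1)) ∨
      (t.1 = 3 ∧ (3 : ℤ) ^ 8 ∣ c6Of [a1, a2, a3, a4, a6] ∧ ¬ (3 : ℤ) ^ 9 ∣ c6Of [a1, a2, a3, a4, a6]))
    (hpΔ : (p : ℤ) ∣ (⟨a1, a2, a3, a4, a6⟩ : WeierstrassCurve ℤ).Δ)
    (hpc₄ : ¬ (p : ℤ) ∣ (⟨a1, a2, a3, a4, a6⟩ : WeierstrassCurve ℤ).c₄) (ℓ₁ ℓ₂ : ℕ) (hℓ₁ : ℓ₁.Prime)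
    (hℓ₂ : ℓ₂.Prime) (h2ℓ₁ : ℓ₁ ≠ 2) (h2ℓ₂ : ℓ₂ ≠ 2) (hpℓ₁ : ℓ₁ ≠ p) (hpℓ₂ : ℓ₂ ≠ p)
    (hΔ₁ : ¬ (ℓ₁ : ℤ) ∣ (⟨a1, a2, a3, a4, a6⟩ : WeierstrassCurve ℤ).Δ)
    (hΔ₂ : ¬ (ℓ₂ : ℤ) ∣ (⟨a1, a2, a3, a4, a6⟩ : WeierstrassCurve ℤ).Δ) {n₁ n₂ : ℕ}
    (hc₁ : countPoints [a1, a2, a3, a4, a6] ℓ₁ = n₁)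
    (hc₂ : countPoints [a1, a2, a3, a4, a6] ℓ₂ = n₂)
    (hi : ∀ c : ZMod p, c ^ 2 - (((ℓ₁ : ℤ) + 1 - n₁ : ℤ) : ZMod p) * c + ℓ₁ ≠ 0)
    (hii : (ℓ₂ : ZMod p) = 1 ∧ (((ℓ₂ : ℤ) + 1 - n₂ : ℤ) : ZMod p) = 2 ∧ ¬ p ^ 2 ∣ n₂)
    (hJ : JetchevDivisibilityCarrierMult)
    (hMcU : McCallum1991_padicValNat_card_sha_primary_add_le_of_globalDivisibility)
    (hGZK : rank_eq_analyticRank_of_analyticRank_le_one)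
    (hKo : ∀ (N : ℕ) [NeZero N] (W : WeierstrassCurve ℚ) (K : Type) [Field K] [NumberField K],
      kolyvagin N W K)
    (hmod : exists_isNewformOf) (W : WeierstrassCurve ℚ) (hW : W = ⟨a1, a2, a3, a4, a6⟩) {N : ℕ}
    [NeZero N] {K : Type} [Field K] [NumberField K] (hK : IsImaginaryQuadratic K)
    (hD3 : NumberField.discr K ≠ -3) (hD4 : NumberField.discr K ≠ -4)
    (hH : SatisfiesHeegnerHypothesis N K) {P : (W.baseChange K).toAffine.Point}
    (hP : IsHeegnerPoint N W K P) (hnt : ¬ IsOfFinAddOrder P)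
    (hI : (haveI := Fact.mk hp;
      padicValNat p (AddSubgroup.zmultiples P).index ≤
      padicValNat p ((W.baseChange ℚ_[p]).localTamagawaNumber ℤ_[p])))
    (hr : W.analyticRank ≤ 1) {s : ℚ} (hs : shaAn W = (s : ℂ)) (hv : padicValRat p s = 0) :
    BSDp W p :=
  bsdp_of_jetRowCarrierMult_of_irr_of_order
    (p := p) (hp := hp) (hp2 := hp2) (a1 := a1) (a2 := a2) (a3 := a3) (a4 := a4) (a6 := a6)
    (h0 := h0) (bad := bad) (hprime := hprime) (hsupp := hsupp) (hmin := hmin) (hpΔ := hpΔ)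
    (hpc₄ := hpc₄) (ℓ₁ := ℓ₁) (ℓ₂ := ℓ₂) (hℓ₁ := hℓ₁) (hℓ₂ := hℓ₂) (h2ℓ₁ := h2ℓ₁) (h2ℓ₂ := h2ℓ₂)
    (hpℓ₁ := hpℓ₁) (hpℓ₂ := hpℓ₂) (hΔ₁ := hΔ₁) (hΔ₂ := hΔ₂) (hc₁ := hc₁) (hc₂ := hc₂) (hi := hi)
    (hii := hii) (hJ := hJ) (hMcU := hMcU) (hGZK := hGZK) (hKo := hKo)
    (hrec := heegnerPointOfConductor_one_galoisConj_forall)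
    (hD36 := (fun N _ W K _ _ => phi_heegnerTau_mem_singularModuliField_holds N W K))
    (hlev := (level_eq_conductorNorm_forall_of_exists_isNewformOf hmod)) (W := W) (hW := hW)
    (hK := hK) (hD3 := hD3) (hD4 := hD4) (hH := hH) (hP := hP) (hnt := hnt) (hI := hI) (hr := hr)
    (hs := hs) (hv := hv)

end Summit.BirchSwinnertonDyer.Rank1Residual.JET
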